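import Summits.QuantumFields.YangMills.Theorems.TwistedTraceScaling.Negative.FlatProximityQuartic
import HarnessLib

/-!
# Negative lemma R8 (exponent form) for crux `TwistedTraceScaling` (stmt-QuantumFields-20203): at fixed `L`, NO modulus `C·S^α` with `α > 1/4` bounds the
# distance to the flat connections — the exponent `1/4` of the repaired brick c5/C3c is SHARP

Standing disprover `ym-cdisprove-20203-1` (gen 8), sequel to `Negative/FlatProximityQuartic.lean` (p566835: the `√σ` form, `α = 1/2`, of lane B's
LOWER-BLUEPRINT §6 brick c5 = lane A's C3c is false).  The same witness — the constant non-commuting connections `twoLinkCfg a_φ b_φ`, with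
`S ≤ 4·#Plaquette·sin⁴φ` but full-period line holonomies `a_{Lφ}`, `b_{Lφ}` at Frobenius distance `≥ sin(Lφ)/√2` from every COMMUTING pair (hence from the
line holonomies of every flat configuration) — kills every exponent above one quarter:

★ `flatProximity_rpow_false (L) [NeZero L] (hα : 1/4 < α)`: there are no `C`, `σ₀ > 0` with
`∀ U, S(U) ≤ σ₀ → ∃ g V, V flat ∧ ∀ e, ‖(g·U)_e − V_e‖_F ≤ C · S(U)^α`.

So the fixed-`L` compactness statement the lanes may use is `dist(g·U, Flat) ≤ C(L)·S(U)^{1/4}` and nothing better (Lüscher's quartic modes); the other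
repair is `√σ`-proximity to the CONSTANT (not necessarily commuting) configurations.  Endgame: `(2Lφ/π)² ≤ sin²(Lφ) ≤ 2L²C²S^{2α} ≤ 2L²C²(K^α)²φ^{8α}`,
i.e. `2 ≤ π²C²(K^α)²·φ^{8α−2} → 0`.

## WHAT THIS IS NOT
Fixed-lattice algebra plus `Real.rpow` bookkeeping on the Negative/ lane (`--supports stmt-QuantumFields-20203`); a statement about a PLANNED AUXILIARY BRICK
of the fixed-lattice programme COARSE(L₀), not about the crux, its stubs, the continuum or the Clay gap.  HONEST FRAMING: femto rung R2b1, stub support of a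
child of a CONDITIONAL reduction route.  Sorry-free, no new definition, axioms ⊆ {propext, Classical.choice, Quot.sound}.
-/

set_option autoImplicit false

noncomputable section

open scoped Matrix Quaternion BigOperators
open Literature.MathematicalPhysics.QuantumFieldTheory hiding SU2
open Literature.MathematicalPhysics.QuantumLattice
open Summit.QuantumFields.YangMills.Theorems.FemtoTransferGap
open Summit.QuantumFields.YangMills.Theorems.FemtoTransferGap.PhysL2 (twoLinkCfg)

namespace Summit.QuantumFields.YangMills.Theorems.TwistedTraceScaling.Negative.R8

/-- The real-arithmetic endgame in exponent form: Jordan `(2/π)Lφ ≤ sin(Lφ)`, the commuting-pair bound `sin²(Lφ) ≤ 2(Lδ)²`, the modulus bound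
`δ² ≤ C²·Kα²·φ²·φ^e` and the smallness `(π²C²Kα² + 1)·φ^e ≤ 1` (`e > 0`) are incompatible. [folklore] -/
theorem flatProximity_endgame_rpow {Lr φ C Kα e δ sn : ℝ} (hL : 0 < Lr) (hφ0 : 0 < φ)
    (hη : (Real.pi ^ 2 * C ^ 2 * Kα ^ 2 + 1) * φ ^ e ≤ 1) (hj : 2 / Real.pi * (Lr * φ) ≤ sn) (hkey : sn ^ 2 ≤ 2 * (Lr * δ) ^ 2)
    (hδ : δ ^ 2 ≤ C ^ 2 * (Kα ^ 2 * (φ ^ 2 * φ ^ e))) : False := by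
  have hπ : 0 < Real.pi := Real.pi_pos
  have hte : 0 < φ ^ e := Real.rpow_pos_of_pos hφ0 e
  have ht : 0 < (Lr * φ) ^ 2 := by positivity
  have hA : (2 / Real.pi * (Lr * φ)) ^ 2 ≤ 2 * Lr ^ 2 * (C ^ 2 * (Kα ^ 2 * (φ ^ 2 * φ ^ e))) :=
    calc (2 / Real.pi * (Lr * φ)) ^ 2 ≤ sn ^ 2 := pow_le_pow_left₀ (by positivity) hj 2
      _ ≤ 2 * (Lr * δ) ^ 2 := hkey
      _ = 2 * Lr ^ 2 * δ ^ 2 := by ring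
      _ ≤ 2 * Lr ^ 2 * (C ^ 2 * (Kα ^ 2 * (φ ^ 2 * φ ^ e))) := mul_le_mul_of_nonneg_left hδ (by positivity)
  have hC : 4 / Real.pi ^ 2 ≤ 2 * C ^ 2 * Kα ^ 2 * φ ^ e := by
    refine le_of_mul_le_mul_right ?_ ht
    calc 4 / Real.pi ^ 2 * (Lr * φ) ^ 2 = (2 / Real.pi * (Lr * φ)) ^ 2 := by ring
      _ ≤ 2 * Lr ^ 2 * (C ^ 2 * (Kα ^ 2 * (φ ^ 2 * φ ^ e))) := hA
      _ = 2 * C ^ 2 * Kα ^ 2 * φ ^ e * (Lr * φ) ^ 2 := by ring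
  have hD : 4 ≤ 2 * C ^ 2 * Kα ^ 2 * φ ^ e * Real.pi ^ 2 := (div_le_iff₀ (by positivity)).1 hC
  linarith

/-- ★ **R8 (exponent form). No modulus `C·S^α`, `α > 1/4`, controls the distance to the flat connections at fixed `L ≥ 1`.**  There are no constants
`C`, `σ₀ > 0` such that every `SU(2)` lattice gauge field `U` on `(ℤ/L)³` with `S(U) ≤ σ₀` is gauge-equivalent to a configuration all of whose links are
within Frobenius distance `C·S(U)^α` of a FLAT configuration.  (`α = 1/2` is `flatProximity_sqrt_false`; `α = 1/4` is the true modulus, attained by the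
constant non-commuting modes.) [cite: Luscher1983, §2] -/
theorem flatProximity_rpow_false (L : ℕ) [NeZero L] {α : ℝ} (hα : 1 / 4 < α) :
    ¬ ∃ C σ₀ : ℝ, 0 < σ₀ ∧ ∀ U : GaugeConfig 3 L SU2, wilsonAction su2Rep U ≤ σ₀ →
        ∃ (g : Site 3 L → SU2) (V : GaugeConfig 3 L SU2), (∀ x i j, plaquetteHolonomy V x i j = 1) ∧
          ∀ e, frobNorm (((gaugeTransform g U e : SU2) : Matrix (Fin 2) (Fin 2) ℂ) - (V e : Matrix (Fin 2) (Fin 2) ℂ)) ≤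
            C * wilsonAction su2Rep U ^ α := by
  rintro ⟨C, σ₀, hσ₀, H⟩
  -- constants of the lattice, the exponent gap and a small angle
  set K : ℝ := 4 * (Fintype.card (Plaquette 3 L) : ℝ) with hK
  have hK0 : 0 ≤ K := by positivity
  have hLpos : (0 : ℝ) < L := Nat.cast_pos.2 (Nat.pos_of_ne_zero (NeZero.ne L))
  have hπ := Real.pi_pos
  have hα0 : 0 ≤ α := by linarith
  have he : 0 < 8 * α - 2 := by linarith
  have hKα0 : 0 ≤ K ^ α := Real.rpow_nonneg hK0 α
  have hM1 : 0 < Real.pi ^ 2 * C ^ 2 * (K ^ α) ^ 2 + 1 := by positivity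
  set φ : ℝ := min (min 1 (Real.pi / 2 / L))
    (min (σ₀ / (K + 1)) ((1 / (Real.pi ^ 2 * C ^ 2 * (K ^ α) ^ 2 + 1)) ^ (8 * α - 2)⁻¹)) with hφ
  have hφ0 : 0 < φ :=
    lt_min (lt_min one_pos (div_pos (by positivity) hLpos)) (lt_min (by positivity) (Real.rpow_pos_of_pos (by positivity) _))
  have hφ1 : φ ≤ 1 := (min_le_left _ _).trans (min_le_left _ _)
  have hφL : (L : ℝ) * φ ≤ Real.pi / 2 := by
    have h : φ ≤ Real.pi / 2 / L := (min_le_left _ _).trans (min_le_right _ _)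
    rw [le_div_iff₀ hLpos] at h; linarith
  have hφσ : (K + 1) * φ ≤ σ₀ := by
    have h : φ ≤ σ₀ / (K + 1) := (min_le_right _ _).trans (min_le_left _ _)
    rw [le_div_iff₀ (by positivity)] at h; linarith
  have hφe : φ ^ (8 * α - 2) ≤ 1 / (Real.pi ^ 2 * C ^ 2 * (K ^ α) ^ 2 + 1) := by
    have h : φ ≤ (1 / (Real.pi ^ 2 * C ^ 2 * (K ^ α) ^ 2 + 1)) ^ (8 * α - 2)⁻¹ := (min_le_right _ _).trans (min_le_right _ _)
    calc φ ^ (8 * α - 2) ≤ ((1 / (Real.pi ^ 2 * C ^ 2 * (K ^ α) ^ 2 + 1)) ^ (8 * α - 2)⁻¹) ^ (8 * α - 2) :=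
        Real.rpow_le_rpow hφ0.le h he.le
      _ = 1 / (Real.pi ^ 2 * C ^ 2 * (K ^ α) ^ 2 + 1) := Real.rpow_inv_rpow (by positivity) he.ne'
  have hηM : (Real.pi ^ 2 * C ^ 2 * (K ^ α) ^ 2 + 1) * φ ^ (8 * α - 2) ≤ 1 := by
    have := mul_le_mul_of_nonneg_left hφe hM1.le
    rwa [mul_one_div_cancel hM1.ne'] at this
  -- the witness
  obtain ⟨a, ha⟩ := exists_su2Quat_eq _ (normSq_axisI φ)
  obtain ⟨b, hb⟩ := exists_su2Quat_eq _ (normSq_axisJ φ)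
  have hsin0 : 0 ≤ Real.sin φ := Real.sin_nonneg_of_nonneg_of_le_pi hφ0.le (by linarith [Real.pi_gt_three])
  have hsin4 : Real.sin φ ^ 4 ≤ φ ^ 4 := pow_le_pow_left₀ hsin0 (Real.sin_le hφ0.le) 4
  have hφ4 : φ ^ 4 ≤ φ := pow_le_of_le_one hφ0.le hφ1 (by norm_num)
  have hS0 : 0 ≤ wilsonAction su2Rep (twoLinkCfg (L := L) a b) := wilsonAction_su2_nonneg_lat _
  have hSφ : wilsonAction su2Rep (twoLinkCfg (L := L) a b) ≤ K * φ ^ 4 :=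
    (wilsonAction_twoLinkCfg_le ha hb).trans (mul_le_mul_of_nonneg_left hsin4 hK0)
  have hSσ : wilsonAction su2Rep (twoLinkCfg (L := L) a b) ≤ σ₀ := by
    have : K * φ ^ 4 ≤ K * φ := mul_le_mul_of_nonneg_left hφ4 hK0
    linarith
  obtain ⟨g, V, hV, hclose⟩ := H _ hSσ
  -- move the gauge transformation onto the flat side
  have hV' : ∀ x i j, plaquetteHolonomy (gaugeTransform (fun x => (g x)⁻¹) V) x i j = 1 :=
    plaquetteHolonomy_gaugeTransform_eq_one hV _
  have hclose' : ∀ e, frobNorm (((twoLinkCfg (L := L) a b e : SU2) : Matrix (Fin 2) (Fin 2) ℂ) -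
      ((gaugeTransform (fun x => (g x)⁻¹) V e : SU2) : Matrix (Fin 2) (Fin 2) ℂ)) ≤
        C * wilsonAction su2Rep (twoLinkCfg (L := L) a b) ^ α := fun e => by
    rw [← frobNorm_gaugeTransform_sub_swap]; exact hclose e
  -- the two full-period line holonomies at the origin
  have hd0 := frobNorm_lineHolonomy_sub_le hclose' 0 L 0
  have hd1 := frobNorm_lineHolonomy_sub_le hclose' 1 L 0
  rw [lineHolonomy_twoLinkCfg_zero] at hd0
  rw [lineHolonomy_twoLinkCfg_one] at hd1
  have hcommV := lineHolonomy_comm_of_flat hV' 0 1 (0 : Site 3 L)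
  have hsL : 0 < Real.sin (L * φ) := Real.sin_pos_of_pos_of_lt_pi (by positivity) (by linarith)
  have hkey := sq_le_of_commute_near_axes hcommV hsL (su2Quat_pow_axisI ha L) (su2Quat_pow_axisJ hb L) hd0 hd1
  have hjordan : 2 / Real.pi * (L * φ) ≤ Real.sin (L * φ) := Real.mul_le_sin (by positivity) hφL
  -- the modulus in terms of `φ`: `(C·S^α)² ≤ C²·(K^α)²·φ²·φ^{8α−2}`
  have hSα : wilsonAction su2Rep (twoLinkCfg (L := L) a b) ^ α ≤ K ^ α * φ ^ (4 * α) :=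
    calc wilsonAction su2Rep (twoLinkCfg (L := L) a b) ^ α ≤ (K * φ ^ 4) ^ α := Real.rpow_le_rpow hS0 hSφ hα0
      _ = K ^ α * (φ ^ 4) ^ α := Real.mul_rpow hK0 (by positivity)
      _ = K ^ α * φ ^ (4 * α) := by
        rw [show φ ^ 4 = φ ^ ((4 : ℕ) : ℝ) from (Real.rpow_natCast φ 4).symm, ← Real.rpow_mul hφ0.le]; norm_num
  have hφpow : (φ ^ (4 * α)) ^ 2 = φ ^ 2 * φ ^ (8 * α - 2) := by
    rw [← Real.rpow_mul_natCast hφ0.le, show 4 * α * ((2 : ℕ) : ℝ) = 2 + (8 * α - 2) by push_cast; ring, Real.rpow_add hφ0,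
      Real.rpow_two]
  have hδ : (C * wilsonAction su2Rep (twoLinkCfg (L := L) a b) ^ α) ^ 2 ≤ C ^ 2 * ((K ^ α) ^ 2 * (φ ^ 2 * φ ^ (8 * α - 2))) :=
    calc (C * wilsonAction su2Rep (twoLinkCfg (L := L) a b) ^ α) ^ 2 = C ^ 2 * (wilsonAction su2Rep (twoLinkCfg (L := L) a b) ^ α) ^ 2 := by ring
      _ ≤ C ^ 2 * (K ^ α * φ ^ (4 * α)) ^ 2 :=
        mul_le_mul_of_nonneg_left (pow_le_pow_left₀ (Real.rpow_nonneg hS0 α) hSα 2) (sq_nonneg C)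
      _ = C ^ 2 * ((K ^ α) ^ 2 * (φ ^ 2 * φ ^ (8 * α - 2))) := by rw [mul_pow, hφpow]
  exact flatProximity_endgame_rpow hLpos hφ0 hηM hjordan hkey hδ

/-- ★ The same without the gauge freedom (`g ≡ 1`). [cite: Luscher1983, §2] -/
theorem flatProximity_rpow_false' (L : ℕ) [NeZero L] {α : ℝ} (hα : 1 / 4 < α) :
    ¬ ∃ C σ₀ : ℝ, 0 < σ₀ ∧ ∀ U : GaugeConfig 3 L SU2, wilsonAction su2Rep U ≤ σ₀ →
        ∃ V : GaugeConfig 3 L SU2, (∀ x i j, plaquetteHolonomy V x i j = 1) ∧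
          ∀ e, frobNorm ((U e : Matrix (Fin 2) (Fin 2) ℂ) - (V e : Matrix (Fin 2) (Fin 2) ℂ)) ≤ C * wilsonAction su2Rep U ^ α := by
  rintro ⟨C, σ₀, hσ₀, H⟩
  refine flatProximity_rpow_false L hα ⟨C, σ₀, hσ₀, fun U hU => ?_⟩
  obtain ⟨V, hV, hclose⟩ := H U hU
  exact ⟨fun _ => 1, V, hV, fun e => by rw [gaugeTransform_one]; exact hclose e⟩

end Summit.QuantumFields.YangMills.Theorems.TwistedTraceScaling.Negative.R8

end
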